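import Mathlib
import HarnessLib
import Summits.Ventures.LatticeQCDFlow.Exactness.NCMCGeneralSpaceEstimatorCLT

/-!
# Asymptotic normality of reweighted observables on a general state space: the ratio delta method

HONEST FRAMING: exact (Metropolis-corrected) sampling algorithms for lattice gauge theory;
figures of merit are autocorrelation/cost numbers at stated couplings and volumes; no
continuum-physics claim.

Venture `LatticeQCDFlow` (cell pub-lqcd), topic `Exactness`; FANOUT row 13 (`eng-snf`, GEN-12).
NEW WORK of the cell (elementary asymptotic statistics on product laws: Mathlib's central limit
theorem, Slutsky's theorem, the strong law), not a published result; nothing is cited as a fact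
(the "delta method" for ratio estimators is named only).  Continuation of
`NCMCGeneralSpaceEstimatorCLT.lean` (CLT for sample means of an i.i.d. run, asymptotic normality
of `ΔF̂`) and of `NCMCGeneralSpaceEstimatorConsistency.lean` (GEN-11: STRONG CONSISTENCY of the
self-normalised estimator `Σ e^{−W_i} f(end_i) / Σ e^{−W_i}`, whose asymptotic law was NOT TYPED).

## Setting and content

`μ` a probability law on records `E`, runs `ω : ℕ → E` under `Measure.infinitePi (fun _ => μ)`.

* `sqrt_mul_ratio_sub_eq` — the algebra `√n (S_A/S_B − r) = (S_B/n)⁻¹ · √n · (S_A − r S_B)/n`;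
  **`tendstoInDistribution_sqrt_mul_ratio_sub`** — THE RATIO DELTA METHOD: for measurable
  `a, b ∈ L²(μ)` with `b > 0`, means `α, β`,
  `√n (Σ_{i<n} a(ω i) / Σ_{i<n} b(ω i) − α/β) →d N(0, Var_μ[a − (α/β) b] / β²)`
  (`a − (α/β) b` is centred, so the CLT of `NCMCGeneralSpaceEstimatorCLT.lean` applies to its
  sample mean; `1/B̄_n → 1/β` a.s. hence in probability; Slutsky).
* **`CrooksPair.tendstoInDistribution_reweighted`** — for every Crooks pair `(κF, κR, s, e, W)` from
  `ν₀` to `ν₁` on a general measurable state space with `e^{−ΔF} = Z₁/Z₀`, every measurable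
  end-point observable `f` with `e^{−W} f(end), e^{−W} ∈ L²(P_F)`, along an infinite run of
  independent forward evolutions from prior equilibrium:
  `√n (Σ_{i<n} e^{−W_i} f(end_i) / Σ_{i<n} e^{−W_i} − m) →d N(0, E_F[e^{−2(W − ΔF)} (f(end) − m)²])`,
  `m = (ν₁ Ω)⁻¹ ∫ f dν₁` the TARGET mean.  The asymptotic variance is the `P_F`-mean of the squared
  dissipation-weighted centred observable `e^{−(W−ΔF)} (f(end) − m)`; for `f` constant it vanishes,
  and the companion statement for `ΔF̂` has variance `E_F[e^{−2(W − ΔF)}] − 1 = 1/ESS_F − 1`.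
  Reading for the engine (`snf.estimators.reweight`, jackknife error bars): for independent
  evolutions the honest large-`N` error bar of a reweighted observable is
  `√(E_F[e^{−2 W_d}(f(end) − m)²] / N)`, NOT `√(Var/ (N · ESS))`-type shortcuts.

Scope / NOT CLAIMED: independent evolutions only (no correlated chain starts, no block jackknife,
no rate of convergence); limits in distribution, not finite-`N` coverage; no value for any concrete
protocol or observable.
-/

namespace Summit.Ventures.LatticeQCDFlow.Exactness.GeneralNCMC

open MeasureTheory ProbabilityTheory Set Filter Finset
open scoped ENNReal NNReal Topology

variable {E : Type*} [MeasurableSpace E]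

/-! ## The ratio delta method for self-normalised estimators along an i.i.d. run -/

section IID

variable (μ : Measure E) [IsProbabilityMeasure μ]
variable {Ω' : Type*} [MeasurableSpace Ω'] {P' : Measure Ω'} [IsProbabilityMeasure P']

/-- `√n (S_A/S_B − r) = (S_B/n)⁻¹ · √n ((S_A − r S_B)/n − 0)` whenever `S_B ≠ 0` for `n ≠ 0`
(both sides vanish at `n = 0`). -/
theorem sqrt_mul_ratio_sub_eq (n : ℕ) {A B : ℝ} (r : ℝ) (hB : n ≠ 0 → B ≠ 0) :
    √(n : ℝ) * (A / B - r) = (B / n)⁻¹ * (√(n : ℝ) * ((A - r * B) / n - 0)) := by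
  rcases Nat.eq_zero_or_pos n with rfl | hn
  · simp
  · have hB' : B ≠ 0 := hB hn.ne'
    have hn' : (n : ℝ) ≠ 0 := by exact_mod_cast hn.ne'
    rw [sub_zero, inv_div]
    field_simp

/-- **The ratio delta method.**  For measurable `a, b ∈ L²(μ)` with `b > 0` and means `α, β`
(so `β > 0`), along an infinite i.i.d. run the self-normalised ratio satisfies
`√n (Σ_{i<n} a(ω i) / Σ_{i<n} b(ω i) − α/β) →d N(0, Var_μ[a − (α/β) b] / β²)`.
Proof: `a − (α/β) b` has mean zero, so the CLT applies to its sample mean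
(`tendstoInDistribution_sqrt_mul_sampleMean_sub`); `1/B̄_n → 1/β` almost surely by the strong law,
hence in probability; Slutsky. -/
theorem tendstoInDistribution_sqrt_mul_ratio_sub {a b : E → ℝ} (ham : Measurable a)
    (hbm : Measurable b) (hbpos : ∀ x, 0 < b x) (ha2 : MemLp a 2 μ) (hb2 : MemLp b 2 μ)
    {Y : Ω' → ℝ}
    (hY : HasLaw Y (gaussianReal 0
      (Var[fun x => a x - (∫ x, a x ∂μ) / (∫ x, b x ∂μ) * b x; μ] / (∫ x, b x ∂μ) ^ 2).toNNReal) P') :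
    TendstoInDistribution
      (fun (n : ℕ) (ω : ℕ → E) => √(n : ℝ) *
        ((∑ i ∈ range n, a (ω i)) / (∑ i ∈ range n, b (ω i)) - (∫ x, a x ∂μ) / (∫ x, b x ∂μ)))
      atTop Y (fun _ => Measure.infinitePi fun _ : ℕ => μ) P' := by
  set α := ∫ x, a x ∂μ with hαdef
  set β := ∫ x, b x ∂μ with hβdef
  have hbi : Integrable b μ := hb2.integrable one_le_two
  have hβ : 0 < β := by
    rw [hβdef, integral_pos_iff_support_of_nonneg (fun x => (hbpos x).le) hbi]
    have hsupp : Function.support b = univ := by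
      ext x
      simp only [Function.mem_support, mem_univ, iff_true]
      exact (hbpos x).ne'
    rw [hsupp, measure_univ]
    exact one_pos
  set r := α / β with hrdef
  have hdm : Measurable fun x => a x - r * b x := ham.sub (hbm.const_mul r)
  have hd2 : MemLp (fun x => a x - r * b x) 2 μ := ha2.sub (hb2.const_mul r)
  have hdmean : ∫ x, a x - r * b x ∂μ = 0 := by
    rw [integral_sub (ha2.integrable one_le_two) (hbi.const_mul r), integral_const_mul, ← hαdef,
      ← hβdef, hrdef, div_mul_cancel₀ _ hβ.ne', sub_self]
  -- the CLT for the sample mean of `a − r b`, against `Y₀ = β·Y ~ N(0, Var (a − r b))`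
  have hY₀ := hasLaw_const_mul_gaussianReal (variance_nonneg _ μ) hβ.ne' rfl hY
  have clt := tendstoInDistribution_sqrt_mul_sampleMean_sub μ hdm hd2 hY₀
  -- `1/B̄_n → 1/β` in probability
  have hCmeas : ∀ n, AEMeasurable (fun ω : ℕ → E => (sampleMean b fun i : Fin n => ω i)⁻¹)
      (Measure.infinitePi fun _ : ℕ => μ) :=
    fun n => (measurable_sampleMean_run hbm n).inv.aemeasurable
  have hC : TendstoInMeasure (Measure.infinitePi fun _ : ℕ => μ)
      (fun n (ω : ℕ → E) => (sampleMean b fun i : Fin n => ω i)⁻¹) atTop (fun _ => β⁻¹) := by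
    refine tendstoInMeasure_of_tendsto_ae (fun n => (hCmeas n).aestronglyMeasurable) ?_
    filter_upwards [tendsto_sampleMean_ae μ hbm hbi] with ω hω
    exact hω.inv₀ hβ.ne'
  have slutsky := clt.continuous_comp_prodMk_of_tendstoInMeasure_const
    (g := fun p : ℝ × ℝ => p.2 * p.1) (by fun_prop) hC hCmeas
  have hlim : (fun ω' => β⁻¹ * (β * Y ω')) = Y := by
    funext ω'
    field_simp
  simp only at slutsky
  rw [hlim] at slutsky
  convert slutsky using 3 with n ω
  rw [hdmean]
  unfold sampleMean
  rw [Fin.sum_univ_eq_sum_range (fun i => a (ω i) - r * b (ω i)) n,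
    Fin.sum_univ_eq_sum_range (fun i => b (ω i)) n, sum_sub_distrib, ← mul_sum]
  refine sqrt_mul_ratio_sub_eq n r fun hn => ?_
  exact (sum_pos (fun i _ => hbpos (ω i)) (nonempty_range_iff.2 hn)).ne'

end IID

/-! ## For a Crooks pair: reweighted end-point observables are asymptotically normal -/

namespace CrooksPair

variable {Ω : Type*} [MeasurableSpace Ω]
variable {ν₀ ν₁ : Measure Ω} {κF κR : Kernel Ω E} {s e : E → Ω} {W : E → ℝ}
variable {Ω' : Type*} [MeasurableSpace Ω'] {P' : Measure Ω'} [IsProbabilityMeasure P']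

/-- **Asymptotic normality of reweighted end-point observables (the ratio delta method for a Crooks
pair).**  For every Crooks pair on a general measurable state space with `e^{−ΔF} = Z₁/Z₀`, every
measurable `f` with `e^{−W} f(end) ∈ L²(P_F)` and `e^{−W} ∈ L²(P_F)`, along an infinite run of
independent forward evolutions the self-normalised estimator of the TARGET mean
`m = (ν₁ Ω)⁻¹ ∫ f dν₁` satisfies
`√n (Σ_{i<n} e^{−W_i} f(end_i) / Σ_{i<n} e^{−W_i} − m) →d N(0, E_F[e^{−2(W − ΔF)} (f(end) − m)²])`.
The asymptotic variance is the `P_F`-mean of the squared DISSIPATION-WEIGHTED centred observable —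
what the engine's jackknife error bar of a reweighted observable estimates for independent
evolutions (for `f ≡ const` it vanishes; compare `1/ESS_F − 1 = E_F[e^{−2(W − ΔF)}] − 1` for `ΔF̂`). -/
theorem tendstoInDistribution_reweighted [IsFiniteMeasure ν₀] [IsFiniteMeasure ν₁]
    [IsMarkovKernel κF] [IsMarkovKernel κR] (h0 : ν₀ univ ≠ 0) (h1 : ν₁ univ ≠ 0)
    (h : CrooksPair ν₀ ν₁ κF κR s e W) {f : Ω → ℝ} (hfm : Measurable f)
    (hA2 : MemLp (fun ε => Real.exp (-W ε) * f (e ε)) 2 (fwdPathLaw ν₀ κF))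
    (hB2 : MemLp (fun ε => Real.exp (-W ε)) 2 (fwdPathLaw ν₀ κF)) {ΔF : ℝ}
    (hΔF : Real.exp (-ΔF) = ((ν₀ univ)⁻¹ * ν₁ univ).toReal) {Y : Ω' → ℝ}
    (hY : HasLaw Y (gaussianReal 0 (∫ ε, Real.exp (-(2 * (W ε - ΔF))) *
      (f (e ε) - ((ν₁ univ)⁻¹).toReal * ∫ y, f y ∂ν₁) ^ 2 ∂(fwdPathLaw ν₀ κF)).toNNReal) P') :
    haveI := isProbabilityMeasure_fwdPathLaw ν₀ h0 κF
    TendstoInDistribution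
      (fun (n : ℕ) (ω : ℕ → E) => √(n : ℝ) *
        ((∑ i ∈ range n, Real.exp (-W (ω i)) * f (e (ω i))) / (∑ i ∈ range n, Real.exp (-W (ω i))) -
          ((ν₁ univ)⁻¹).toReal * ∫ y, f y ∂ν₁))
      atTop Y (fun _ => Measure.infinitePi fun _ : ℕ => fwdPathLaw ν₀ κF) P' := by
  haveI := isProbabilityMeasure_fwdPathLaw ν₀ h0 κF
  set m := ((ν₁ univ)⁻¹).toReal * ∫ y, f y ∂ν₁ with hmdef
  have ham : Measurable fun ε => Real.exp (-W ε) * f (e ε) :=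
    (Real.measurable_exp.comp h.measurable_W.neg).mul (hfm.comp h.measurable_e)
  have hbm : Measurable fun ε => Real.exp (-W ε) := Real.measurable_exp.comp h.measurable_W.neg
  have hZ1 : (ν₁ univ).toReal ≠ 0 := (ENNReal.toReal_pos h1 (measure_ne_top ν₁ univ)).ne'
  have hZ0 : (ν₀ univ).toReal ≠ 0 := (ENNReal.toReal_pos h0 (measure_ne_top ν₀ univ)).ne'
  have hβ : ∫ ε, Real.exp (-W ε) ∂(fwdPathLaw ν₀ κF) = Real.exp (-ΔF) := by
    rw [h.integral_exp_neg_work, hΔF]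
  -- the ratio of the two means is the target mean `m`
  have hr : (∫ ε, Real.exp (-W ε) * f (e ε) ∂(fwdPathLaw ν₀ κF)) /
      (∫ ε, Real.exp (-W ε) ∂(fwdPathLaw ν₀ κF)) = m := by
    rw [h.integral_exp_neg_work_mul_comp_end hfm.aestronglyMeasurable, h.integral_exp_neg_work,
      ENNReal.toReal_mul, ENNReal.toReal_inv, hmdef, ENNReal.toReal_inv]
    field_simp
  -- the variance of `a − m b = e^{−W}(f∘e − m)` over `β² = e^{−2ΔF}`
  have hd2 : MemLp (fun ε => Real.exp (-W ε) * f (e ε) - m * Real.exp (-W ε)) 2 (fwdPathLaw ν₀ κF) :=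
    hA2.sub (hB2.const_mul m)
  have hdmean : ∫ ε, Real.exp (-W ε) * f (e ε) - m * Real.exp (-W ε) ∂(fwdPathLaw ν₀ κF) = 0 := by
    rw [integral_sub (hA2.integrable one_le_two) ((hB2.integrable one_le_two).const_mul m),
      integral_const_mul, ← hr, div_mul_cancel₀ _ (hβ ▸ Real.exp_pos _).ne', sub_self]
  have hvar : Var[fun ε => Real.exp (-W ε) * f (e ε) - m * Real.exp (-W ε); fwdPathLaw ν₀ κF] /
      (∫ ε, Real.exp (-W ε) ∂(fwdPathLaw ν₀ κF)) ^ 2 =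
      ∫ ε, Real.exp (-(2 * (W ε - ΔF))) * (f (e ε) - m) ^ 2 ∂(fwdPathLaw ν₀ κF) := by
    rw [variance_eq_sub hd2, hdmean, hβ, zero_pow two_ne_zero, sub_zero, ← integral_div]
    refine integral_congr_ae (Eventually.of_forall fun ε => ?_)
    simp only [Pi.pow_apply]
    have hexp : Real.exp (-(2 * (W ε - ΔF))) = Real.exp (-W ε) ^ 2 / Real.exp (-ΔF) ^ 2 := by
      rw [sq, sq, ← Real.exp_add, ← Real.exp_add, ← Real.exp_sub]
      congr 1
      ring
    rw [hexp]
    have hne : Real.exp (-ΔF) ^ 2 ≠ 0 := pow_ne_zero 2 (Real.exp_pos _).ne'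
    field_simp
  rw [← hvar, ← hr] at hY
  have main := tendstoInDistribution_sqrt_mul_ratio_sub (fwdPathLaw ν₀ κF) ham hbm
    (fun ε => Real.exp_pos _) hA2 hB2 hY
  rw [hr] at main
  exact main

end CrooksPair

end Summit.Ventures.LatticeQCDFlow.Exactness.GeneralNCMC
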